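import Summits.ResolutionOfSingularities.ResolutionOfSingularities.Theorems.DeltaCutSing
import HarnessLib

/-!
# DeltaCutSing2 — tree file 2/6 of the decomp-res lens-6 g30 node «SingCut» (HOME `decomp-res-lens-6/g30/SingCut.lean` + `SingCutCertificates.lean`)

§SDefs continued — THE LETTERS of the singular run: `SMoves`, `STerminates`, `SFrozen`, `SPerpetual`, the stuck readings
`not_sMoves_iff` / `sFrozen_iff_stuck_nonempty` / `sStuck_iff_singSing`, exclusivity, `s_trichotomy`, `not_sTerminates_iff`, the prefix
identities with g28's `gRun`, and THE SUB-KIND THEOREMS `gFrozen_sing_sMoves`, `GFrozen.sFrozen_of_not_singRegular`,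
`GFrozen.sMoves_or_sFrozen` (+ `GTerminates.sTerminates`, `GPerpetual.sPerpetual`).
The module docstring of `DeltaCutSing` (file 1/6) carries the node's summary (the law, the letters, the cells, the honest ceiling and
the sources); `NODE-g30.md` (HOME) is the record.  Same namespace `…Theorems.DeltaCutClasses`, declarations verbatim from the lens
file. [new] [folklore]
-/

noncomputable section

open CategoryTheory CategoryTheory.Limits AlgebraicGeometry TopologicalSpace IsLocalRing
open Literature.AlgebraicGeometry.Resolution

universe u

namespace Summit.ResolutionOfSingularities.ResolutionOfSingularities.Theorems.DeltaCutClasses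

open Summit.ResolutionOfSingularities.ResolutionOfSingularities.Theorems.TwistCutClasses
open Summit.ResolutionOfSingularities.ResolutionOfSingularities.Theorems.LightCutClasses

section SLetters

open Summit.ResolutionOfSingularities.ResolutionOfSingularities.Theorems
open WeakOrderReduction ForcedTowerClasses SubfieldContactClasses AbsoluteContactClasses PurityValveClasses
open Scheme.IdealSheafData (vanishingIdeal)

/-! #### Letters -/

/-- `SMoves n R` — the singular hop MOVES at `R`: g28's graded hop moves, or the singular hop fires. DEFINITION (letter). -/
def SMoves (n : ℕ) (R : RefStage) : Prop := GMoves n R ∨ SingNow n R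

/-- **`STerminates n R`** — the singular run TERMINATES: a moving prefix, then a level with nothing pending and EMPTY bad locus.
DEFINITION (letter; the DECIDED kind). -/
def STerminates (n : ℕ) (R : RefStage) : Prop :=
  ∃ h : ℕ, (∀ j < h, SMoves n (sRun n R j)) ∧ (sRun n R h).pending = none ∧ BadEmpty n (sRun n R h).base

/-- **`SFrozen n R`** — the singular run FREEZES: a moving prefix, then a level with nothing pending, NONEMPTY bad locus,
IRREGULAR reduced closure, not a curve, IRREGULAR surface part AND IRREGULAR REDUCED CLOSURE OF ITS SINGULAR LOCUS (kind F-ss²;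
inhabitant T₃ = `z³ + (tuw)⁴`, char 3: three coordinate planes, singular along three concurrent axes). DEFINITION (letter;
RESIDUAL). -/
def SFrozen (n : ℕ) (R : RefStage) : Prop :=
  ∃ h : ℕ, (∀ j < h, SMoves n (sRun n R j)) ∧ (sRun n R h).pending = none ∧ ¬ BadEmpty n (sRun n R h).base ∧
    ¬ ClosureRegular n (sRun n R h).base ∧ ¬ DimLEOne (badClosure n (sRun n R h).base) ∧
    ¬ SurfaceRegular n (sRun n R h).base ∧ ¬ SingRegular n (sRun n R h).base

/-- **`SPerpetual n R`** — the singular run is PERPETUAL: every level moves (kind P‴).  UNDECIDED · NO INHABITANT KNOWN · never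
«expected-empty».  P‴ ABSORBS g28's P″ (`GPerpetual.sPerpetual`) AND THE RECURRENCE of firing stages: a run that meets
`SingFrozen` levels infinitely often is PERPETUAL, not eliminated — the node eliminates `SingFrozen` LEVELS, not their
recurrence. DEFINITION (letter; RESIDUAL). -/
def SPerpetual (n : ℕ) (R : RefStage) : Prop := ∀ i : ℕ, SMoves n (sRun n R i)

/-- a refined stage that MOVES under g28's graded hop is NOT a firing stage of the singular hop (a `SingFrozen` level is
graded-stuck: `not_gMoves_of_surfSing`). [new] [folklore] -/
theorem not_singNow_of_gMoves {n : ℕ} {R : RefStage} (h : GMoves n R) : ¬ SingNow n R :=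
  fun hs => not_gMoves_of_surfSing hs.1 hs.2.1 hs.2.2.1 hs.2.2.2.1 hs.2.2.2.2.1 h

/-- **THE NON-MOVING LEVELS READ EXACTLY**: the singular hop does not move iff nothing is pending and the level is bad-empty or
stuck at a nonempty bad locus with irregular non-curve closure, irregular surface part AND IRREGULAR Sing-closure. [new]
[folklore] -/
theorem not_sMoves_iff {n : ℕ} {R : RefStage} : ¬ SMoves n R ↔ R.pending = none ∧
    (BadEmpty n R.base ∨ (¬ BadEmpty n R.base ∧ ¬ ClosureRegular n R.base ∧ ¬ DimLEOne (badClosure n R.base) ∧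
      ¬ SurfaceRegular n R.base ∧ ¬ SingRegular n R.base)) := by
  constructor
  · intro h
    obtain ⟨hP, hc⟩ := not_gMoves_iff.mp fun hm => h (Or.inl hm)
    refine ⟨hP, hc.imp id fun ⟨hne, hirr, hdim, hs⟩ =>
      ⟨hne, hirr, hdim, hs, fun hsg => h (Or.inr ⟨hP, hne, hirr, hdim, hs, hsg⟩)⟩⟩
  · rintro ⟨hP, hc⟩ (hm | ⟨_, hS⟩)
    · exact not_gMoves_iff.mpr ⟨hP, hc.imp id fun ⟨hne, hirr, hdim, hs, _⟩ => ⟨hne, hirr, hdim, hs⟩⟩ hm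
    · rcases hc with he | ⟨_, _, _, _, hsg⟩
      · exact hS.1 he
      · exact hsg hS.2.2.2.2

/-- **THE FROZEN LETTER IS LITERALLY KIND F-ss²** (hypothesis-free): the singular run freezes iff its FIRST MOTIONLESS level has a
NONEMPTY bad locus. [new] [folklore] -/
theorem sFrozen_iff_stuck_nonempty {n : ℕ} {R : RefStage} :
    SFrozen n R ↔ ∃ h : ℕ, (∀ j < h, SMoves n (sRun n R j)) ∧ ¬ SMoves n (sRun n R h) ∧ ¬ BadEmpty n (sRun n R h).base := by
  constructor
  · rintro ⟨h, hpre, hP, hne, hirr, hdim, hs, hsg⟩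
    exact ⟨h, hpre, not_sMoves_iff.mpr ⟨hP, Or.inr ⟨hne, hirr, hdim, hs, hsg⟩⟩, hne⟩
  · rintro ⟨h, hpre, hstop, hne⟩
    obtain ⟨hP, he | ⟨_, hirr, hdim, hs, hsg⟩⟩ := not_sMoves_iff.mp hstop
    · exact absurd he hne
    · exact ⟨h, hpre, hP, hne, hirr, hdim, hs, hsg⟩

/-- **SINGLE-LEVEL FORM OF THE SUB-KIND THEOREM** (hypothesis-free, NON-TAUTOLOGICAL): a level is STUCK with a NONEMPTY bad locus
iff it is LITERALLY of kind F-ss² — nothing pending, bad locus nonempty, reduced closure irregular, not a curve, surface part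
irregular, Sing-closure irregular.  In particular NO `SingFrozen` level (H-type, D′-type), no F-top level, no active level, no
curve-frozen level and no pending phase is ever stuck. [new] [folklore] -/
theorem sStuck_iff_singSing {n : ℕ} {R : RefStage} :
    (¬ SMoves n R ∧ ¬ BadEmpty n R.base) ↔ (R.pending = none ∧ ¬ BadEmpty n R.base ∧ ¬ ClosureRegular n R.base ∧
      ¬ DimLEOne (badClosure n R.base) ∧ ¬ SurfaceRegular n R.base ∧ ¬ SingRegular n R.base) := by
  constructor
  · rintro ⟨hstop, hne⟩
    obtain ⟨hP, he | ⟨_, hirr, hdim, hs, hsg⟩⟩ := not_sMoves_iff.mp hstop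
    · exact absurd he hne
    · exact ⟨hP, hne, hirr, hdim, hs, hsg⟩
  · rintro ⟨hP, hne, hirr, hdim, hs, hsg⟩
    exact ⟨not_sMoves_iff.mpr ⟨hP, Or.inr ⟨hne, hirr, hdim, hs, hsg⟩⟩, hne⟩

/-- **THE DOOR READING**: a graded-STUCK level with a nonempty bad locus whose Sing-closure is REGULAR is a FIRING stage of the
singular hop (g28's `gStuck_iff_surfSing` + the new test). [new] [folklore] -/
theorem singNow_of_gStuck {n : ℕ} {R : RefStage} (hstop : ¬ GMoves n R) (hne : ¬ BadEmpty n R.base)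
    (hsg : SingRegular n R.base) : SingNow n R := by
  obtain ⟨hP, hne', hirr, hdim, hs⟩ := gStuck_iff_surfSing.mp ⟨hstop, hne⟩
  exact ⟨hP, hne', hirr, hdim, hs, hsg⟩

/-- a level with nothing pending and empty bad locus does not move. [new] [folklore] -/
theorem not_sMoves_of_badEmpty {n : ℕ} {R : RefStage} (hP : R.pending = none) (he : BadEmpty n R.base) : ¬ SMoves n R :=
  not_sMoves_iff.mpr ⟨hP, Or.inl he⟩

/-- a level with nothing pending, nonempty bad locus, irregular non-curve closure, irregular surface part and IRREGULAR
Sing-closure does not move. [new] [folklore] -/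
theorem not_sMoves_of_singSing {n : ℕ} {R : RefStage} (hP : R.pending = none) (hne : ¬ BadEmpty n R.base)
    (hirr : ¬ ClosureRegular n R.base) (hdim : ¬ DimLEOne (badClosure n R.base)) (hs : ¬ SurfaceRegular n R.base)
    (hsg : ¬ SingRegular n R.base) : ¬ SMoves n R :=
  not_sMoves_iff.mpr ⟨hP, Or.inr ⟨hne, hirr, hdim, hs, hsg⟩⟩

/-- exclusivity: a terminating singular run is not perpetual. [new] [folklore] -/
theorem STerminates.not_sPerpetual {n : ℕ} {R : RefStage} (h : STerminates n R) : ¬ SPerpetual n R :=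
  fun hP => by obtain ⟨i, _, hP0, he⟩ := h; exact not_sMoves_of_badEmpty hP0 he (hP i)

/-- exclusivity: a frozen singular run is not perpetual. [new] [folklore] -/
theorem SFrozen.not_sPerpetual {n : ℕ} {R : RefStage} (h : SFrozen n R) : ¬ SPerpetual n R :=
  fun hP => by
    obtain ⟨i, _, hP0, hne, hirr, hdim, hs, hsg⟩ := h
    exact not_sMoves_of_singSing hP0 hne hirr hdim hs hsg (hP i)

/-- exclusivity: a terminating singular run is not frozen (the first non-moving level is unique). [new] [folklore] -/
theorem STerminates.not_sFrozen {n : ℕ} {R : RefStage} (h : STerminates n R) : ¬ SFrozen n R := by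
  rintro ⟨i', hpre', hP', hne', hirr', hdim', hs', hsg'⟩
  obtain ⟨i, hpre, hP0, he⟩ := h
  rcases lt_trichotomy i i' with hlt | rfl | hgt
  · exact not_sMoves_of_badEmpty hP0 he (hpre' i hlt)
  · exact hne' he
  · exact not_sMoves_of_singSing hP' hne' hirr' hdim' hs' hsg' (hpre i' hgt)

/-- **TRICHOTOMY OF THE SINGULAR RUN** (hypothesis-free): it terminates, or freezes (kind F-ss²), or is perpetual. [new]
[folklore] -/
theorem s_trichotomy (n : ℕ) (R : RefStage) : STerminates n R ∨ SFrozen n R ∨ SPerpetual n R := by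
  classical
  by_cases hP : SPerpetual n R
  · exact Or.inr (Or.inr hP)
  · have hex : ∃ i : ℕ, ¬ SMoves n (sRun n R i) := not_forall.mp hP
    have hh : ¬ SMoves n (sRun n R (Nat.find hex)) := Nat.find_spec hex
    have hpre : ∀ j < Nat.find hex, SMoves n (sRun n R j) := fun j hj => not_not.mp (Nat.find_min hex hj)
    obtain ⟨hP0, he | ⟨hne, hirr, hdim, hs, hsg⟩⟩ := not_sMoves_iff.mp hh
    · exact Or.inl ⟨Nat.find hex, hpre, hP0, he⟩
    · exact Or.inr (Or.inl ⟨Nat.find hex, hpre, hP0, hne, hirr, hdim, hs, hsg⟩)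

/-- **THE RESIDUAL LETTER READ EXACTLY**: `¬ STerminates ⟺ SFrozen ∨ SPerpetual` (hypothesis-free). [new] [folklore] -/
theorem not_sTerminates_iff (n : ℕ) (R : RefStage) : ¬ STerminates n R ↔ SFrozen n R ∨ SPerpetual n R := by
  constructor
  · intro h
    rcases s_trichotomy n R with ht | hf | hp
    · exact absurd ht h
    · exact Or.inl hf
    · exact Or.inr hp
  · rintro (hf | hp) ht
    · exact ht.not_sFrozen hf
    · exact ht.not_sPerpetual hp

/-- a non-moving refined stage is fixed by g28's graded hop. [folklore] -/
theorem gHop_next_eq_of_not_gMoves {n : ℕ} {Q : RefStage} (hQ : ¬ GMoves n Q) : (gHop n Q).next = Q := by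
  rw [gHop_eq_refHop fun hg => hQ (Or.inr hg)]
  exact refHop_next_eq_of_not_refMoves fun hm => hQ (Or.inl hm)

/-- a non-moving refined stage is fixed by the singular hop. [folklore] -/
theorem sHop_next_eq_of_not_sMoves {n : ℕ} {Q : RefStage} (hQ : ¬ SMoves n Q) : (sHop n Q).next = Q := by
  rw [sHop_eq_gHop fun hs => hQ (Or.inr hs)]
  exact gHop_next_eq_of_not_gMoves fun hm => hQ (Or.inl hm)

/-- **A NON-MOVING LEVEL IS FINAL**: from the first non-moving level on, the singular run STAYS. [new] [folklore] -/
theorem sRun_eq_of_not_moves {n : ℕ} {R : RefStage} {h : ℕ} (hh : ¬ SMoves n (sRun n R h)) :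
    ∀ i : ℕ, h ≤ i → sRun n R i = sRun n R h := by
  intro i hi
  obtain ⟨d, rfl⟩ := Nat.exists_eq_add_of_le hi
  induction d with
  | zero => rfl
  | succ d ih => rw [← Nat.add_assoc, sRun_succ, ih (Nat.le_add_right h d), sHop_next_eq_of_not_sMoves hh]

/-! #### The singular run EXTENDS the graded run: below the first firing stage the two coincide -/

/-- on a prefix WITHOUT firing stages the singular run IS g28's graded run. [new] [folklore] -/
theorem sRun_eq_gRun_of_not_singNow {n : ℕ} (R : RefStage) {h : ℕ} (hpre : ∀ j < h, ¬ SingNow n (gRun n R j)) :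
    ∀ i ≤ h, sRun n R i = gRun n R i := by
  intro i
  induction i with
  | zero => intro _; rfl
  | succ i ih =>
    intro hi
    rw [sRun_succ, ih (Nat.le_of_succ_le hi), sHop_eq_gHop (hpre i (Nat.lt_of_succ_le hi)), gRun_succ]

/-- on a prefix along which g28's graded run MOVES the singular run IS the graded run. [new] [folklore] -/
theorem sRun_eq_gRun_of_gMoves {n : ℕ} (R : RefStage) {h : ℕ} (hpre : ∀ j < h, GMoves n (gRun n R j)) :
    ∀ i ≤ h, sRun n R i = gRun n R i :=
  sRun_eq_gRun_of_not_singNow R fun j hj => not_singNow_of_gMoves (hpre j hj)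

/-- **g28's DECIDED CELL SITS INSIDE THE SINGULAR DECIDED CELL**: a terminating graded run is a terminating singular run (same
height). [new] [folklore] -/
theorem GTerminates.sTerminates {n : ℕ} {R : RefStage} (h : GTerminates n R) : STerminates n R := by
  obtain ⟨h, hpre, hP, he⟩ := h
  refine ⟨h, fun j hj => ?_, ?_, ?_⟩
  · rw [sRun_eq_gRun_of_gMoves R hpre j hj.le]; exact Or.inl (hpre j hj)
  · rw [sRun_eq_gRun_of_gMoves R hpre h le_rfl]; exact hP
  · rw [sRun_eq_gRun_of_gMoves R hpre h le_rfl]; exact he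

/-- a perpetual graded run is a perpetual singular run (kind P″ ⊆ kind P‴). [new] [folklore] -/
theorem GPerpetual.sPerpetual {n : ℕ} {R : RefStage} (h : GPerpetual n R) : SPerpetual n R := fun i => by
  rw [sRun_eq_gRun_of_gMoves R (h := i) (fun j _ => h j) i le_rfl]; exact Or.inl (h i)

/-- **THE SUB-KIND THEOREM · THE SUB-KIND «F-surf-sing WITH REGULAR Sing-closure» IS GONE**: a graded run FROZEN at level `h`
(moving prefix, nothing pending) whose frozen level is `SingFrozen` — bad `≠ ∅`, closure irregular, not a curve, surface part
irregular, Sing-closure REGULAR: H, D′₃ — is a singular run that MOVES at level `h`, and the move IS the singular hop (step 1,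
and step 2 when the old surface part's strict transform is regular). [new] [folklore] -/
theorem gFrozen_sing_sMoves {n : ℕ} {R : RefStage} {h : ℕ} (hpre : ∀ j < h, GMoves n (gRun n R j))
    (hP : (gRun n R h).pending = none) (hS : SingFrozen n (gRun n R h).base) :
    SMoves n (sRun n R h) ∧ sRun n R h = gRun n R h ∧
      (OldSurfRegular n (gRun n R h).base → sRun n R (h + 1) = ⟨singStepTwo n (gRun n R h).base, none⟩) ∧
      (¬ OldSurfRegular n (gRun n R h).base → sRun n R (h + 1) = ⟨singStepOne n (gRun n R h).base, none⟩) := by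
  have e : sRun n R h = gRun n R h := sRun_eq_gRun_of_gMoves R hpre h le_rfl
  refine ⟨by rw [e]; exact Or.inr ⟨hP, hS⟩, e, fun h₂ => ?_, fun h₂ => ?_⟩
  · rw [sRun_succ, e, sHop_next_of_regular ⟨hP, hS⟩ h₂]
  · rw [sRun_succ, e, sHop_next_of_not_regular ⟨hP, hS⟩ h₂]

/-- a graded run frozen at a level with IRREGULAR Sing-closure is a frozen singular run (kind F-ss² is what remains of kind
F-surf-sing; T₃). [new] [folklore] -/
theorem GFrozen.sFrozen_of_not_singRegular {n : ℕ} {R : RefStage} {h : ℕ} (hpre : ∀ j < h, GMoves n (gRun n R j))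
    (hP : (gRun n R h).pending = none) (hne : ¬ BadEmpty n (gRun n R h).base) (hirr : ¬ ClosureRegular n (gRun n R h).base)
    (hdim : ¬ DimLEOne (badClosure n (gRun n R h).base)) (hs : ¬ SurfaceRegular n (gRun n R h).base)
    (hsg : ¬ SingRegular n (gRun n R h).base) : SFrozen n R := by
  refine ⟨h, fun j hj => ?_, ?_⟩
  · rw [sRun_eq_gRun_of_gMoves R hpre j hj.le]; exact Or.inl (hpre j hj)
  · rw [sRun_eq_gRun_of_gMoves R hpre h le_rfl]; exact ⟨hP, hne, hirr, hdim, hs, hsg⟩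

/-- the graded residual kind F-surf-sing and the singular letters: a graded-FROZEN run is singular-MOVING at its frozen level
(`SingFrozen`) or singular-FROZEN there (F-ss²) — excluded middle on the new test. [new] [folklore] -/
theorem GFrozen.sMoves_or_sFrozen {n : ℕ} {R : RefStage} (h : GFrozen n R) :
    (∃ h : ℕ, (∀ j < h, GMoves n (gRun n R j)) ∧ SingFrozen n (gRun n R h).base ∧ SMoves n (sRun n R h)) ∨ SFrozen n R := by
  obtain ⟨h, hpre, hP, hne, hirr, hdim, hs⟩ := h
  by_cases hsg : SingRegular n (gRun n R h).base
  · exact Or.inl ⟨h, hpre, ⟨hne, hirr, hdim, hs, hsg⟩, (gFrozen_sing_sMoves hpre hP ⟨hne, hirr, hdim, hs, hsg⟩).1⟩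
  · exact Or.inr (GFrozen.sFrozen_of_not_singRegular hpre hP hne hirr hdim hs hsg)

end SLetters

end Summit.ResolutionOfSingularities.ResolutionOfSingularities.Theorems.DeltaCutClasses
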